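import Literature.AnabelianGeometry.SemiGraphs.TemperedReconstructionCompat
import Literature.AnabelianGeometry.SemiGraphs.TemperedReconstructionR1Proofs
import Literature.AnabelianGeometry.SemiGraphs.TemperedVerticialNamedFactsProofs
import Literature.AnabelianGeometry.SemiGraphs.TemperedMaximalCompact
import Literature.AnabelianGeometry.SemiGraphs.OneVertexWitnessChart
import Literature.AnabelianGeometry.SemiGraphs.ThetaRayMaximalCompactEscapingFreeProP
import Literature.AnabelianGeometry.SemiGraphs.TemperedExtensionCountable
import Mathlib.Topology.Algebra.ClopenNhdofOne
import HarnessLib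

/-!
# `¬ QuasiGeometricGraphDataCompat`, `¬ Cor39Compat`: the ∀-countable typed forms of [SemiAnbd] Cor 3.9 over
# the COMPATIBLE reading of Def 3.8 are false as typed (F-2770, F-2771), at the pair
# (one-vertex `B(F̂₂⁽ᵖ⁾)`, `𝒢_θ(p, n)`)

Mochizuki, *Semi-graphs of anabelioids*, Publ. RIMS **42** (2006) [MochizukiSemiAnbd2006], §3, Definition 3.8
and Corollary 3.9, manuscript pp. 42–43 [cite: MochizukiSemiAnbd2006, Cor 3.9 p.42]: "Let `G`, `H` be
connected, countable, quasi-coherent, totally elevated, totally estranged, verticially slim graphs of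
anabelioids.  Then applying '`B^temp(−)`' determines a natural bijective correspondence between locally open
morphisms … `G → H` and quasi-geometric morphisms … `B^temp(G) → B^temp(H)`"; Def 3.8 (p. 42) defines
quasi-geometric through MAXIMAL COMPACT subgroups, which Thm 3.7 (iv) identifies with the verticial subgroups —
the printed proof of Thm 3.7 (iii)/(iv) being for FINITE underlying semi-graphs (kernel theorems
`compactInVerticialAt_of_finiteGraph`, `maximalCompactIffVerticialAt_of_finiteGraph`; the cell's ∀-countable
typings refuted at abc-iut-L3-d1's countermodel `𝒢_θ`: p442260, p443103).

PROOF-ONLY file (abc-iut cell, F-wave seat abc-iut-f-175 gen 2, FACT-LIST rows F-2770 / F-2771 of tranche 175;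
0 definitions, no named fact).  THE WITNESS: `𝒢 := OneVertex.graph (F̂₂⁽ᵖ⁾)` (one vertex, no edge, vertex group
the free pro-`p` group of rank 2 — slim, with the characteristic open cores as level family; explicit chart
`π₁^temp(𝒢) = F̂₂⁽ᵖ⁾` on the nose, abc-iut-L3-t2's `OneVertex.chart`), `ℋ := 𝒢_θ(p, n)` (canonical chart), and
`φ := ζ ∘ χ_a : F̂₂⁽ᵖ⁾ ↠ ℤ_p → π₁^temp(𝒢_θ)` with `ζ` the parametrisation of the escaping procyclic
`C = closure⟨c⟩` (`ThetaRayMaximalCompactEscapingFreeProP.lean`: `C` is a MAXIMAL compact subgroup lying in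
NO verticial subgroup).  Then:

* `φ` is (compatibly) quasi-geometric AS TYPED: the only maximal compact subgroup of the compact `F̂₂⁽ᵖ⁾` is
  `⊤`, mapped ONTO the maximal compact `C` (the clauses on pairs of distinct maximal compact subgroups are
  vacuous) — `isCompatiblyQuasiGeometric_of_range_isMaximalCompactSubgroup`;
* no morphism `F : 𝒢 → ℋ` is compatible with `φ` on verticial homomorphisms (`Hom.CompatV`): with `ψ := id`
  (verticial for the explicit chart) and any verticial `ψ'` at `F v` (Thm 3.7 (i), `verticialInjective_holds`)
  it would put `C = range φ` inside a verticial subgroup of `π₁^temp(𝒢_θ)` — `not_compatV_of_range_not_le`;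
* hence **`not_quasiGeometricGraphDataCompat : ¬ QuasiGeometricGraphDataCompat.{0}`** (F-2770) and, through
  step (R1) `InducesCompatible_holds` (`Induces ⇒ CompatV`, abc-iut-L3-t10), clause (b) fails too:
  **`not_cor39Compat : ¬ Cor39Compat.{0}`** (F-2771) — a CHOICE-INDEPENDENT refutation (contrast the twist
  witness of abc-iut-w6-d089, 10:13:47Z, which cannot decide `Cor39Compat` (b)); the literal forms
  `QuasiGeometricGraphData` / `Cor39` fall with their twins (refutations of record: p439444, via the fold).

REPAIRED STATEMENTS = the FINITE-graph instance forms, PROVED: `quasiGeometricGraphDataCompatAt_of_finiteGraph`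
(p433487), `cor39CompatUpToTwistAt_of_finite` (abc-iut-w4-d064, p431134).  HONEST FRAMING: this refutes the
cell's ∀-COUNTABLE TYPING of Cor 3.9 (hypotheses as amended by [IUTchI] Rmk 2.5.3) — at an INFINITE graph of
anabelioids, where "maximal compact = verticial" fails; [SemiAnbd] Cor 3.9 as printed and as USED (finite dual
semi-graphs in [IUTchI–IV]) is not claimed false; no side is taken on [IUTchIII] Cor. 3.12.
-/

noncomputable section

namespace Literature.AnabelianGeometry.SemiGraphs

namespace ProfiniteSemiGraph

open CategoryTheory Topology Multiplicative Filter
open Literature.AlgebraicGeometry.Frobenioids (IsSlimGroup)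

/-! ### A homomorphism from a one-vertex graph onto a non-verticial maximal compact subgroup -/

section Witness

variable {P : Type} [Group P] [TopologicalSpace P] [IsTopologicalGroup P] [CompactSpace P]
  [TotallyDisconnectedSpace P]

omit [IsTopologicalGroup P] [TotallyDisconnectedSpace P] in
/-- In a compact group the only maximal compact subgroup is `⊤`. [cite: MochizukiSemiAnbd2006, Thm 3.7(iv) p.41] -/
theorem eq_top_of_isMaximalCompactSubgroup_of_compactSpace {K : Subgroup P} (hK : IsMaximalCompactSubgroup K) :
    K = ⊤ :=
  (hK.2 ⊤ (by rw [Subgroup.coe_top]; exact isCompact_univ) le_top).symm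

omit [IsTopologicalGroup P] [TotallyDisconnectedSpace P] in
/-- **A continuous homomorphism from a compact group whose range is a maximal compact subgroup is
COMPATIBLY QUASI-GEOMETRIC as typed** (Def 3.8, both readings): the unique maximal compact subgroup `⊤` of
the source maps onto its range, open in itself; the clauses on two DISTINCT maximal compact subgroups are
vacuous. [cite: MochizukiSemiAnbd2006, Def 3.8 p.42] -/
theorem isCompatiblyQuasiGeometric_of_range_isMaximalCompactSubgroup {Γ : Type} [Group Γ]
    [TopologicalSpace Γ] (φ : P →ₜ* Γ) (hmax : IsMaximalCompactSubgroup φ.toMonoidHom.range) :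
    IsCompatiblyQuasiGeometric φ := by
  refine ⟨⟨fun K₁ hK₁ => ?_, fun K₁ H₁ hK₁ hH₁ hne _ => ?_⟩, fun K₁ H₁ hK₁ hH₁ hne _ => ?_⟩
  · obtain rfl := eq_top_of_isMaximalCompactSubgroup_of_compactSpace hK₁
    refine ⟨φ.toMonoidHom.range, hmax, le_of_eq (MonoidHom.range_eq_map _).symm, ?_⟩
    have : (Subtype.val : φ.toMonoidHom.range → Γ) ⁻¹'
        (((⊤ : Subgroup P).map φ.toMonoidHom : Subgroup Γ) : Set Γ) = Set.univ := by
      rw [← MonoidHom.range_eq_map]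
      exact Set.eq_univ_of_forall fun x => x.2
    rw [this]
    exact isOpen_univ
  · exact absurd ((eq_top_of_isMaximalCompactSubgroup_of_compactSpace hK₁).trans
      (eq_top_of_isMaximalCompactSubgroup_of_compactSpace hH₁).symm) hne
  · exact absurd ((eq_top_of_isMaximalCompactSubgroup_of_compactSpace hK₁).trans
      (eq_top_of_isMaximalCompactSubgroup_of_compactSpace hH₁).symm) hne

variable [SecondCountableTopology P]

/-- **No morphism `OneVertex.graph P → ℋ` is compatible on verticial homomorphisms with a `φ` whose range lies
in no verticial subgroup of `π₁^temp(ℋ)`** (explicit chart of the one-vertex graph: `ψ := id` is verticial;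
Thm 3.7 (i) supplies a verticial `ψ'` at `F v`; `CompatV` conjugates `φ = φ ∘ id` into `ψ' ∘ F_v`).
[cite: MochizukiSemiAnbd2006, Cor 3.9 p.42] -/
theorem not_compatV_of_range_not_le (L : LevelFamily P) {ℋ : ProfiniteSemiGraph.{0}}
    (hℋ : ℋ.Thm37Hypotheses) (cℋ : TemperedPiChart ℋ) (φ : P →ₜ* cℋ.G)
    (hnv : ¬ ∃ (v : ℋ.graph.Vertex) (H : Subgroup cℋ.G), H ∈ verticialSubgroups cℋ v ∧
      φ.toMonoidHom.range ≤ H)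
    (F : Hom (OneVertex.graph P) ℋ) :
    ¬ F.CompatV (OneVertex.chart L) cℋ (φ : (OneVertex.chart L).G →ₜ* cℋ.G) := by
  intro hV
  obtain ⟨⟨_, ψ', hψ', rfl⟩, -⟩ :=
    verticialInjective_holds ℋ hℋ cℋ (F.base.vertexMap PUnit.unit)
  obtain ⟨g, hg⟩ := hV PUnit.unit (ContinuousMonoidHom.id P) ψ' (OneVertex.isVerticialHom_id L _) hψ'
  refine hnv ⟨F.base.vertexMap PUnit.unit, _, conj_mem_verticialSubgroups cℋ ⟨ψ', hψ', rfl⟩ g, ?_⟩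
  rintro _ ⟨x, rfl⟩
  refine ⟨ψ' (F.hV PUnit.unit x), ⟨F.hV PUnit.unit x, rfl⟩, ?_⟩
  change g * ψ' (F.hV PUnit.unit x) * g⁻¹ = φ x
  exact (hg x).symm

/-- **`QuasiGeometricGraphDataCompat` fails at (`OneVertex.graph P`, `ℋ`)** as soon as `P` is slim with a level
family and `φ : P →ₜ* π₁^temp(ℋ)` has for range a MAXIMAL compact subgroup lying in no verticial subgroup.
[cite: MochizukiSemiAnbd2006, Cor 3.9 pp.42-43] -/
theorem not_quasiGeometricGraphDataCompat_of_witness (L : LevelFamily P) (hslim : IsSlimGroup P)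
    {ℋ : ProfiniteSemiGraph.{0}} (hℋ : Cor39Hypotheses ℋ) (cℋ : TemperedPiChart ℋ) (φ : P →ₜ* cℋ.G)
    (hmax : IsMaximalCompactSubgroup φ.toMonoidHom.range)
    (hnv : ¬ ∃ (v : ℋ.graph.Vertex) (H : Subgroup cℋ.G), H ∈ verticialSubgroups cℋ v ∧
      φ.toMonoidHom.range ≤ H) :
    ¬ QuasiGeometricGraphDataCompat.{0} := by
  intro hR2
  have h𝒢 : Cor39Hypotheses (OneVertex.graph P) :=
    ⟨OneVertex.prop36Hypotheses L hslim, OneVertex.isTotallyEstranged, ⟨fun b => nomatch b⟩⟩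
  obtain ⟨F, -, hV, -⟩ := hR2 (OneVertex.graph P) ℋ h𝒢 hℋ (OneVertex.chart L) cℋ φ
    (isCompatiblyQuasiGeometric_of_range_isMaximalCompactSubgroup φ hmax)
  exact not_compatV_of_range_not_le L hℋ.thm37Hypotheses cℋ φ hnv F hV

/-- **`Cor39Compat` fails at the same pair**: clause (b) would produce a locally open `F` INDUCING `φ`, and an
induced homomorphism is compatible on verticial homomorphisms (step (R1), `InducesCompatible_holds`).
[cite: MochizukiSemiAnbd2006, Cor 3.9 p.42] -/
theorem not_cor39Compat_of_witness (L : LevelFamily P) (hslim : IsSlimGroup P)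
    {ℋ : ProfiniteSemiGraph.{0}} (hℋ : Cor39Hypotheses ℋ) (cℋ : TemperedPiChart ℋ) (φ : P →ₜ* cℋ.G)
    (hmax : IsMaximalCompactSubgroup φ.toMonoidHom.range)
    (hnv : ¬ ∃ (v : ℋ.graph.Vertex) (H : Subgroup cℋ.G), H ∈ verticialSubgroups cℋ v ∧
      φ.toMonoidHom.range ≤ H) :
    ¬ Cor39Compat.{0} := by
  intro hC
  have h𝒢 : Cor39Hypotheses (OneVertex.graph P) :=
    ⟨OneVertex.prop36Hypotheses L hslim, OneVertex.isTotallyEstranged, ⟨fun b => nomatch b⟩⟩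
  obtain ⟨F, -, hind, -⟩ := (hC (OneVertex.graph P) ℋ h𝒢 hℋ (OneVertex.chart L) cℋ).2 φ
    (isCompatiblyQuasiGeometric_of_range_isMaximalCompactSubgroup φ hmax)
  exact not_compatV_of_range_not_le L hℋ.thm37Hypotheses cℋ φ hnv F
    (InducesCompatible_holds (OneVertex.graph P) ℋ h𝒢 hℋ (OneVertex.chart L) cℋ F φ hind).1

end Witness

/-! ### The source group `F̂₂⁽ᵖ⁾`: level family and Galois-countability -/

section Source

open Literature.AnabelianGeometry.SemiGraphs.FreeProPRankTwo

variable (p : ℕ) [hp : Fact p.Prime]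

/-- The characteristic open cores `G(p^d)` of `F̂₂⁽ᵖ⁾` form a level family (open, normal, finite index,
cofinal among the open subgroups, of unbounded index `≥ p^d`). [cite: MochizukiSemiAnbd2006, Def 2.3 pp.24-25] -/
theorem nonempty_levelFamily_grp : Nonempty (LevelFamily (Grp p)) := by
  refine ⟨{ N := fun d => charOpenCore (Grp p) (p ^ d)
            normal := fun d => normal_charOpenCore p (p ^ d)
            isOpen := fun d => FreeProPRankTwo.isOpen_charOpenCore p (p ^ d)
            finiteQuotient := fun d => ?_
            basis := fun U hU h1 => ?_
            unbounded := fun M => ⟨M, ?_⟩ }⟩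
  · haveI := finiteIndex_charOpenCore p (p ^ d)
    exact Subgroup.finite_quotient_of_finiteIndex
  · obtain ⟨H, hH⟩ := ProfiniteGrp.exist_openNormalSubgroup_sub_open_nhds_of_one hU h1
    haveI : H.toSubgroup.FiniteIndex := H.toOpenSubgroup.finiteIndex_of_finite_quotient
    refine ⟨H.toSubgroup.index, fun x hx => hH ?_⟩
    have hle : charOpenCore (Grp p) (p ^ H.toSubgroup.index) ≤ H.toSubgroup :=
      (charOpenCore_anti (Nat.lt_pow_self hp.out.one_lt).le).trans
        (charOpenCore_le_of_finiteIndex _ H.isOpen)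
    exact hle hx
  · haveI := finiteIndex_charOpenCore p (p ^ M)
    have hdvd := Subgroup.index_dvd_of_le (charOpenCore_le_ker_χaMod p M)
    rw [index_ker_χaMod] at hdvd
    exact (Nat.lt_pow_self hp.out.one_lt).le.trans
      (Nat.le_of_dvd (Nat.pos_of_ne_zero Subgroup.FiniteIndex.index_ne_zero) hdvd)

omit hp in
/-- The characteristic open cores form a basis of neighbourhoods of `1` in `F̂₂⁽ᵖ⁾`.
[cite: MochizukiSemiAnbd2006, Rmk 3.1.1 p.33] -/
theorem hasBasis_charOpenCore :
    (𝓝 (1 : Grp p)).HasBasis (fun _ : ℕ => True) (fun d => (charOpenCore (Grp p) d : Set (Grp p))) := by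
  refine ⟨fun t => ⟨fun ht => ?_, fun ⟨d, _, hd⟩ => ?_⟩⟩
  · obtain ⟨u, hut, hu, h1u⟩ := mem_nhds_iff.mp ht
    obtain ⟨H, hH⟩ := ProfiniteGrp.exist_openNormalSubgroup_sub_open_nhds_of_one hu h1u
    haveI : H.toSubgroup.FiniteIndex := H.toOpenSubgroup.finiteIndex_of_finite_quotient
    refine ⟨H.toSubgroup.index, trivial, fun x hx => hut (hH ?_)⟩
    exact charOpenCore_le_of_finiteIndex _ H.isOpen hx
  · exact Filter.mem_of_superset ((FreeProPRankTwo.isOpen_charOpenCore p d).mem_nhds (one_mem _)) hd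

omit hp in
/-- `F̂₂⁽ᵖ⁾` is second countable (a countable basis of neighbourhoods of `1` by finite-index subgroups; [IUTchI]
Rmk 2.5.3 (i) (T6)). [cite: MochizukiSemiAnbd2006, Rmk 3.1.1 p.33] -/
theorem secondCountableTopology_grp : SecondCountableTopology (Grp p) :=
  TemperedExtension.secondCountableTopology_of_subgroupBasis (hasBasis_charOpenCore p) (Set.to_countable _)
    fun d _ => by
      haveI := finiteIndex_charOpenCore p d
      haveI : Finite (Grp p ⧸ charOpenCore (Grp p) d) := Subgroup.finite_quotient_of_finiteIndex
      infer_instance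

end Source

/-! ### The refutations -/

open Literature.AnabelianGeometry.SemiGraphs.FreeProPRankTwo in
/-- **`¬ QuasiGeometricGraphDataCompat` (F-2770 is FALSE as typed)** — witness (`OneVertex.graph (F̂₂⁽ᵖ⁾)`,
`𝒢_θ(p, k ↦ k+1)`, `φ := ζ ∘ χ_a`), any prime `p` (here `p = 2`).  Repaired statement: the FINITE-graph form
`quasiGeometricGraphDataCompatAt_of_finiteGraph` (PROVED). [cite: MochizukiSemiAnbd2006, Cor 3.9 pp.42-43] -/
theorem not_quasiGeometricGraphDataCompat : ¬ QuasiGeometricGraphDataCompat.{0} := by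
  haveI : Fact (Nat.Prime 2) := ⟨Nat.prime_two⟩
  obtain ⟨h36, ζ, h37, hmax, hnv⟩ :=
    thetaRayFreeProP_exists_maximalCompact_escaping 2 (fun k => k + 1) (fun k => Nat.le_succ k)
  obtain ⟨L⟩ := nonempty_levelFamily_grp 2
  haveI : SecondCountableTopology (Grp 2) := secondCountableTopology_grp 2
  have hℋ : Cor39Hypotheses (thetaRayFreeProP 2 fun k => k + 1) :=
    ⟨h36, h37.isTotallyEstranged, thetaRay_isGraph (G := Grp 2) (E := Multiplicative ℤ_[2]) (up := α 2)
      (low := fun k => θα 2 (k + 1))⟩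
  have hrange : (ζ.comp (χa 2)).toMonoidHom.range = ζ.toMonoidHom.range := by
    change (ζ.toMonoidHom.comp (χa 2).toMonoidHom).range = _
    rw [MonoidHom.range_comp, MonoidHom.range_eq_top.mpr (χa_surjective 2), ← MonoidHom.range_eq_map]
  refine not_quasiGeometricGraphDataCompat_of_witness L (isSlimGroup 2) hℋ _ (ζ.comp (χa 2)) ?_ ?_
  · rw [hrange]; exact hmax
  · rw [hrange]; exact hnv

open Literature.AnabelianGeometry.SemiGraphs.FreeProPRankTwo in
/-- **`¬ Cor39Compat` (F-2771 is FALSE as typed; clause (b), choice-independent)** — same witness.  Repaired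
statement: the FINITE-graph up-to-twist form `cor39CompatUpToTwistAt_of_finite` (abc-iut-w4-d064, PROVED).
[cite: MochizukiSemiAnbd2006, Cor 3.9 p.42] -/
theorem not_cor39Compat : ¬ Cor39Compat.{0} := by
  haveI : Fact (Nat.Prime 2) := ⟨Nat.prime_two⟩
  obtain ⟨h36, ζ, h37, hmax, hnv⟩ :=
    thetaRayFreeProP_exists_maximalCompact_escaping 2 (fun k => k + 1) (fun k => Nat.le_succ k)
  obtain ⟨L⟩ := nonempty_levelFamily_grp 2
  haveI : SecondCountableTopology (Grp 2) := secondCountableTopology_grp 2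
  have hℋ : Cor39Hypotheses (thetaRayFreeProP 2 fun k => k + 1) :=
    ⟨h36, h37.isTotallyEstranged, thetaRay_isGraph (G := Grp 2) (E := Multiplicative ℤ_[2]) (up := α 2)
      (low := fun k => θα 2 (k + 1))⟩
  have hrange : (ζ.comp (χa 2)).toMonoidHom.range = ζ.toMonoidHom.range := by
    change (ζ.toMonoidHom.comp (χa 2).toMonoidHom).range = _
    rw [MonoidHom.range_comp, MonoidHom.range_eq_top.mpr (χa_surjective 2), ← MonoidHom.range_eq_map]
  refine not_cor39Compat_of_witness L (isSlimGroup 2) hℋ _ (ζ.comp (χa 2)) ?_ ?_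
  · rw [hrange]; exact hmax
  · rw [hrange]; exact hnv

end ProfiniteSemiGraph

end Literature.AnabelianGeometry.SemiGraphs

end
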